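import Mathlib
import Literature.MathematicalPhysics.QuantumLattice.GermMarkov
import Literature.MathematicalPhysics.QuantumLattice.BallSpecification
import Literature.Probability.Independence.IndepCondExp
import HarnessLib

/-!
# From thick-shell splitting to germ-measurable conditional probabilities (Rozanov)

Topic `MathematicalPhysics/QuantumLattice` (random fields on `𝓢'(E)`, files `RandomField`,
`BallSpecification`, `GermMarkov`). THEOREM-ONLY file: the one-sided passage from Rozanov's COLLAR form
of the Markov property to its SHARP GERM form (Yu. A. Rozanov, *Markov Random Fields*, Springer 1982,
Ch. 2 §1.3, (1.27) ⇒ (1.29)), for the sphere `∂B(c, r)` of a law `μ` on field configurations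
`FieldConfig E = 𝓢'(E)`, `E` a finite-dimensional real normed space:

* `CondIndepCondExp.setIntegral_condExp_indicator_eq`, `CondIndepCondExp.condExp_indicator_ae_eq_sup`,
  `CondIndepCondExp.measure_inter_eq_setLIntegral` (general measurable space `Ω`, finite measure):
  if `m'` splits `m₁` and `m₂` (`CondIndepCondExp m' m₁ m₂ μ`, file `GermMarkov`) and `s ∈ m₁`, then
  `μ⟦s | m'⟧` is already a version of `μ⟦s | m' ⊔ m₂⟧` — conditioning additionally on the independent
  side changes nothing (Rozanov 1982, Ch. 2 §1.1, the equivalence of (1.1) with (1.4):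
  `P(A | 𝔄' ∨ 𝔄₂) = P(A | 𝔄')`); π–λ over the rectangles `u ∩ t`, `u ∈ m'`, `t ∈ m₂`
  (`Literature.Probability.Independence.generateFrom_setOf_inter_eq_sup`).
* `extEvents_compl_closedBall_le_shell_sup`, `extEvents_compl_closedBall_eq_shell_sup`: the exterior
  events of the closed ball `B̄(c, r)` are generated by the events of the open shell
  `B(c, r + ε) ∖ B̄(c, r)` together with the events outside `B̄(c, r + ε/2)` (smooth cutoff:
  a test function supported off `B̄(c, r)` splits as `χ f + (1 - χ) f` with `χ` a `ContDiffBump`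
  equal to `1` on `B̄(c, r + 3ε/5)` and supported in `B̄(c, r + 4ε/5)`).
* `measure_inter_eq_setLIntegral_condExp_shell`: hence, if the shell events split the interior events
  `extEvents (ball c r)` from the far-exterior events `extEvents (closedBall c (r + ε/2))ᶜ`, then
  `μ⟦A | shell_ε⟧` is a version of `μ[A | extEvents (closedBall c r)ᶜ]` for interior `A`.
* `exists_germMeasurable_version_of_shellSplitting` (**Rozanov (1.27) ⇒ (1.29), one-sided**): if this
  holds for EVERY width `ε > 0`, every interior event `A` has a `germEvents c r`-measurable `g` with
  `μ (A ∩ B) = ∫⁻_B g dμ` for all exterior events `B` (take `g = limsup_n μ⟦A | shell_{1/(n+1)}⟧`: the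
  versions are pairwise a.e. equal and the shells decrease to the germ σ-algebra).

The last statement is exactly the hypothesis of the kernel-version lemma `exists_properGermKernel`
(`BallSpecificationProperKernels.lean`), so together they turn thick-shell conditional independence at
all widths into proper germ-Markov ball kernels.

## References

* Yu. A. Rozanov, *Markov Random Fields*, Springer (1982), Ch. 2 §1.1 (splitting σ-algebras, (1.1)–(1.4)),
  §1.3 ((1.25)–(1.29): collar and germ forms of the Markov property). [Rozanov1982]
* M. Röckner, Comm. Math. Phys. 106 (1986) 105–135, §1 (local specifications for Euclidean fields).
  [Rockner1986]

## Mathlib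

Used: `MeasureTheory.condExp` with the notation `μ⟦s | m⟧` (`open scoped ProbabilityTheory`),
`setIntegral_condExp`, `integral_condExp`, `condExp_mul_of_stronglyMeasurable_right` (pull-out),
`ae_eq_condExp_of_forall_setIntegral_eq`, `MeasurableSpace.induction_on_inter`, `ContDiffBump`,
`HasCompactSupport.hasTemperateGrowth`, `SchwartzMap.smulLeftCLM` / `tsupport_smulLeftCLM_subset`,
`Measurable.limsup`, `Filter.limsup_nat_add`. Not in Mathlib at the pin: any statement that a
conditionally independent σ-algebra drops out of the conditioning (only the unconditional
`condExp_indep_eq`), cf. `Literature/Probability/Independence/IndepCondExp.lean` for the unconditional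
analogue with an extra conditioning field.
-/

noncomputable section

namespace Literature.MathematicalPhysics.QuantumLattice

open _root_.MeasureTheory _root_.ProbabilityTheory Set Filter Metric
open scoped ENNReal SchwartzMap
open Literature.Probability.Independence

/-! ### Splitting σ-algebras: conditioning on the independent side changes nothing -/

section Splitting

variable {Ω : Type*}

/-- **Set integrals of `μ⟦s | m'⟧` over `m' ∨ m₂`-sets under splitting.** If `m'` splits `m₁` and
`m₂` under the finite measure `μ` (`CondIndepCondExp m' m₁ m₂ μ`) and `s ∈ m₁`, then
`∫_S μ⟦s | m'⟧ dμ = μ(s ∩ S)` for every `S ∈ m' ∨ m₂` (π–λ from the rectangles `u ∩ t`, `u ∈ m'`,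
`t ∈ m₂`, where `∫_{u ∩ t} μ⟦s | m'⟧ = ∫_u μ⟦s | m'⟧ μ⟦t | m'⟧ = ∫_u μ⟦s ∩ t | m'⟧ = μ(s ∩ t ∩ u)` by the
pull-out property and the splitting hypothesis). Rozanov 1982, Ch. 2 §1.1, (1.1) ⇒ (1.4).
[cite: Rozanov1982, Ch. 2 §1.1] -/
theorem CondIndepCondExp.setIntegral_condExp_indicator_eq {m' m₁ m₂ m₀ : MeasurableSpace Ω}
    {μ : Measure Ω} [IsFiniteMeasure μ] (hm' : m' ≤ m₀) (hm₁ : m₁ ≤ m₀) (hm₂ : m₂ ≤ m₀)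
    (h : CondIndepCondExp m' m₁ m₂ μ) {s : Set Ω} (hs : MeasurableSet[m₁] s) {S : Set Ω}
    (hS : MeasurableSet[m' ⊔ m₂] S) :
    ∫ x in S, (μ⟦s | m'⟧) x ∂μ = ∫ x in S, s.indicator (fun _ => (1 : ℝ)) x ∂μ := by
  have hsΩ : MeasurableSet[m₀] s := hm₁ s hs
  have h₁₂ : m' ⊔ m₂ ≤ m₀ := sup_le hm' hm₂
  have hfi : Integrable (s.indicator fun _ => (1 : ℝ)) μ := (integrable_const 1).indicator hsΩ
  have hgi : Integrable (μ⟦s | m'⟧) μ := integrable_condExp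
  refine @MeasurableSpace.induction_on_inter Ω (m' ⊔ m₂)
    (fun S _ => ∫ x in S, (μ⟦s | m'⟧) x ∂μ = ∫ x in S, s.indicator (fun _ => (1 : ℝ)) x ∂μ) _
    (generateFrom_setOf_inter_eq_sup m' m₂).symm (isPiSystem_setOf_inter m' m₂)
    ?_ ?_ ?_ ?_ S hS
  · simp
  · rintro _ ⟨u, t, hu, ht, rfl⟩
    have htΩ : MeasurableSet[m₀] t := hm₂ t ht
    have hprod : (t.indicator fun _ => (1 : ℝ)) * μ⟦s | m'⟧ = t.indicator (μ⟦s | m'⟧) := by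
      funext x
      by_cases hx : x ∈ t <;> simp [hx]
    have hti : Integrable (t.indicator fun _ => (1 : ℝ)) μ := (integrable_const 1).indicator htΩ
    have hprodi : Integrable ((t.indicator fun _ => (1 : ℝ)) * μ⟦s | m'⟧) μ := by
      rw [hprod]; exact hgi.indicator htΩ
    have hpull : μ[(t.indicator fun _ => (1 : ℝ)) * μ⟦s | m'⟧ | m'] =ᵐ[μ]
        μ⟦t | m'⟧ * μ⟦s | m'⟧ :=
      condExp_mul_of_stronglyMeasurable_right stronglyMeasurable_condExp hprodi hti
    have hsti : Integrable ((s ∩ t).indicator fun _ => (1 : ℝ)) μ :=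
      (integrable_const 1).indicator (hsΩ.inter htΩ)
    calc ∫ x in u ∩ t, (μ⟦s | m'⟧) x ∂μ
        = ∫ x in u, t.indicator (μ⟦s | m'⟧) x ∂μ := (setIntegral_indicator htΩ).symm
      _ = ∫ x in u, (μ[(t.indicator fun _ => (1 : ℝ)) * μ⟦s | m'⟧ | m']) x ∂μ := by
          rw [← hprod]; exact (setIntegral_condExp hm' hprodi hu).symm
      _ = ∫ x in u, (μ⟦s | m'⟧ * μ⟦t | m'⟧) x ∂μ := by
          refine integral_congr_ae (ae_restrict_of_ae ?_)
          filter_upwards [hpull] with x hx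
          rw [hx, Pi.mul_apply, Pi.mul_apply, mul_comm]
      _ = ∫ x in u, (μ⟦s ∩ t | m'⟧) x ∂μ :=
          integral_congr_ae (ae_restrict_of_ae (h s t hs ht).symm)
      _ = ∫ x in u, (s ∩ t).indicator (fun _ => (1 : ℝ)) x ∂μ := setIntegral_condExp hm' hsti hu
      _ = ∫ x in u ∩ t, s.indicator (fun _ => (1 : ℝ)) x ∂μ := by
          rw [setIntegral_indicator (hsΩ.inter htΩ), setIntegral_indicator hsΩ, Set.inter_assoc,
            Set.inter_comm t s]
  · intro S hSm hS
    have hS₀ : MeasurableSet[m₀] S := h₁₂ S hSm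
    have h1 := integral_add_compl hS₀ hgi
    have h2 := integral_add_compl hS₀ hfi
    rw [integral_condExp hm'] at h1
    linarith
  · intro F hdisj hFm hF
    have hF₀ : ∀ i, MeasurableSet[m₀] (F i) := fun i => h₁₂ _ (hFm i)
    rw [integral_iUnion hF₀ hdisj hgi.integrableOn, integral_iUnion hF₀ hdisj hfi.integrableOn]
    exact tsum_congr hF

/-- **Under splitting, `μ⟦s | m'⟧` is a version of `μ⟦s | m' ∨ m₂⟧`** for `s ∈ m₁`: conditioning
additionally on the conditionally independent σ-algebra `m₂` changes nothing (Rozanov 1982, Ch. 2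
§1.1, (1.1) ⇔ (1.4): `P(A | 𝔄' ∨ 𝔄₂) = P(A | 𝔄')`, `A ∈ 𝔄₁`). [cite: Rozanov1982, Ch. 2 §1.1] -/
theorem CondIndepCondExp.condExp_indicator_ae_eq_sup {m' m₁ m₂ m₀ : MeasurableSpace Ω}
    {μ : Measure Ω} [IsFiniteMeasure μ] (hm' : m' ≤ m₀) (hm₁ : m₁ ≤ m₀) (hm₂ : m₂ ≤ m₀)
    (h : CondIndepCondExp m' m₁ m₂ μ) {s : Set Ω} (hs : MeasurableSet[m₁] s) :
    μ⟦s | m'⟧ =ᵐ[μ] μ⟦s | m' ⊔ m₂⟧ :=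
  ae_eq_condExp_of_forall_setIntegral_eq (sup_le hm' hm₂)
    ((integrable_const 1).indicator (hm₁ s hs)) (fun _ _ _ => integrable_condExp.integrableOn)
    (fun _ hS _ => h.setIntegral_condExp_indicator_eq hm' hm₁ hm₂ hs hS)
    (stronglyMeasurable_condExp.mono (le_sup_left : m' ≤ m' ⊔ m₂)).aestronglyMeasurable

/-- **Measure form**: under splitting, `μ (s ∩ S) = ∫⁻_S μ⟦s | m'⟧ dμ` for `s ∈ m₁` and every
`S ∈ m' ∨ m₂` (the conditional probability given the splitting σ-algebra integrates to the joint
measure on all of `m' ∨ m₂`). [cite: Rozanov1982, Ch. 2 §1.1] -/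
theorem CondIndepCondExp.measure_inter_eq_setLIntegral {m' m₁ m₂ m₀ : MeasurableSpace Ω}
    {μ : Measure Ω} [IsFiniteMeasure μ] (hm' : m' ≤ m₀) (hm₁ : m₁ ≤ m₀) (hm₂ : m₂ ≤ m₀)
    (h : CondIndepCondExp m' m₁ m₂ μ) {s : Set Ω} (hs : MeasurableSet[m₁] s) {S : Set Ω}
    (hS : MeasurableSet[m' ⊔ m₂] S) :
    μ (s ∩ S) = ∫⁻ x in S, ENNReal.ofReal ((μ⟦s | m'⟧) x) ∂μ := by
  have hsΩ : MeasurableSet[m₀] s := hm₁ s hs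
  have hnn : 0 ≤ᵐ[μ] μ⟦s | m'⟧ :=
    condExp_nonneg (Eventually.of_forall fun x => Set.indicator_nonneg (fun _ _ => zero_le_one) x)
  rw [← ofReal_integral_eq_lintegral_ofReal integrable_condExp.integrableOn (ae_restrict_of_ae hnn),
    h.setIntegral_condExp_indicator_eq hm' hm₁ hm₂ hs hS, setIntegral_indicator hsΩ,
    setIntegral_const, smul_eq_mul, mul_one, ofReal_measureReal, Set.inter_comm]

end Splitting

/-! ### Exterior events of a closed ball = shell events ∨ far-exterior events -/

section Shell

variable {E : Type*} [NormedAddCommGroup E] [NormedSpace ℝ E] [FiniteDimensional ℝ E]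

/-- **Exterior events are generated by a shell and the far exterior**: for `0 ≤ r` and `ε > 0`,
`extEvents (closedBall c r)ᶜ ≤ extEvents (ball c (r + ε) ∖ closedBall c r) ⊔ extEvents (far)`,
`far = (closedBall c (r + ε/2))ᶜ`. A test function `f` supported off `B̄(c, r)` splits as `f = χ f + (1 - χ) f` with `χ` a smooth bump
equal to `1` on `B̄(c, r + 3ε/5)` and supported in `B̄(c, r + 4ε/5)`; the first summand is a test
function supported in the open shell, the second one is supported off `B̄(c, r + ε/2)`, so `ω ↦ ω f`
is measurable for the join (Rozanov 1982, Ch. 2 §1.3, additivity (1.19) of the σ-algebras of a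
generalized random function). [cite: Rozanov1982, Ch. 2 §1.3] -/
theorem extEvents_compl_closedBall_le_shell_sup (c : E) {r ε : ℝ} (hr : 0 ≤ r) (hε : 0 < ε) :
    extEvents (E := E) (closedBall c r)ᶜ ≤
      extEvents (ball c (r + ε) \ closedBall c r) ⊔ extEvents (closedBall c (r + ε / 2))ᶜ := by
  -- the smooth cutoff
  let χ : ContDiffBump c := ⟨r + 3 * ε / 5, r + 4 * ε / 5, by linarith, by linarith⟩
  have hχg : Function.HasTemperateGrowth (χ : E → ℝ) :=
    χ.hasCompactSupport.hasTemperateGrowth χ.contDiff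
  have h1χg : Function.HasTemperateGrowth (fun x : E => 1 - χ x) :=
    (Function.HasTemperateGrowth.const 1).sub hχg
  refine iSup₂_le fun f hf => ?_
  -- the two pieces of `f`
  obtain ⟨f₁, hf₁⟩ : ∃ f₁ : 𝓢(E, ℝ), f₁ = SchwartzMap.smulLeftCLM ℝ (χ : E → ℝ) f := ⟨_, rfl⟩
  obtain ⟨f₂, hf₂⟩ : ∃ f₂ : 𝓢(E, ℝ), f₂ = SchwartzMap.smulLeftCLM ℝ (fun x : E => 1 - χ x) f :=
    ⟨_, rfl⟩
  have hsum : f₁ + f₂ = f := by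
    ext x
    rw [add_apply, hf₁, hf₂, SchwartzMap.smulLeftCLM_apply_apply hχg,
      SchwartzMap.smulLeftCLM_apply_apply h1χg, smul_eq_mul, smul_eq_mul]
    ring
  have h₁ : tsupport (f₁ : E → ℝ) ⊆ ball c (r + ε) \ closedBall c r := by
    intro x hx
    rw [hf₁] at hx
    have hx' := SchwartzMap.tsupport_smulLeftCLM_subset (χ : E → ℝ) f hx
    refine ⟨?_, hf hx'.1⟩
    have hxχ : x ∈ closedBall c χ.rOut := χ.tsupport_eq ▸ hx'.2
    rw [mem_closedBall] at hxχ
    rw [mem_ball]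
    calc dist x c ≤ r + 4 * ε / 5 := hxχ
      _ < r + ε := by linarith
  have h₂ : tsupport (f₂ : E → ℝ) ⊆ (closedBall c (r + ε / 2))ᶜ := by
    intro x hx
    rw [hf₂] at hx
    have hx' := (SchwartzMap.tsupport_smulLeftCLM_subset (fun x : E => 1 - χ x) f hx).2
    have hsub : tsupport (fun x : E => 1 - χ x) ⊆ (ball c χ.rIn)ᶜ := by
      refine closure_minimal (fun y hy hyb => ?_) isOpen_ball.isClosed_compl
      exact hy (show 1 - χ y = 0 by rw [χ.one_of_mem_closedBall (ball_subset_closedBall hyb), sub_self])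
    have hx'' := hsub hx'
    rw [mem_compl_iff, mem_ball, not_lt] at hx''
    rw [mem_compl_iff, mem_closedBall, not_le]
    calc r + ε / 2 < r + 3 * ε / 5 := by linarith
      _ ≤ dist x c := hx''
  have hm₁ : Measurable[extEvents (ball c (r + ε) \ closedBall c r)] fun ω : FieldConfig E => ω f₁ :=
    measurable_eval_of_tsupport_subset h₁
  have hm₂ : Measurable[extEvents (closedBall c (r + ε / 2))ᶜ] fun ω : FieldConfig E => ω f₂ :=
    measurable_eval_of_tsupport_subset h₂
  have key : Measurable[extEvents (ball c (r + ε) \ closedBall c r) ⊔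
      extEvents (closedBall c (r + ε / 2))ᶜ] fun ω : FieldConfig E => ω f := by
    have heq : (fun ω : FieldConfig E => ω f) = fun ω => ω f₁ + ω f₂ := by
      funext ω
      rw [← map_add, hsum]
    rw [heq]
    exact (hm₁.mono le_sup_left le_rfl).add (hm₂.mono le_sup_right le_rfl)
  exact key.comap_le

/-- **Exterior events = shell events ∨ far-exterior events** (`0 ≤ r`, `ε > 0`):
`extEvents (closedBall c r)ᶜ = extEvents (ball c (r + ε) ∖ closedBall c r) ⊔ extEvents (far)`,
`far = (closedBall c (r + ε/2))ᶜ` (the reverse inclusion is monotonicity of `extEvents`). [cite: Rozanov1982, Ch. 2 §1.3] -/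
theorem extEvents_compl_closedBall_eq_shell_sup (c : E) {r ε : ℝ} (hr : 0 ≤ r) (hε : 0 < ε) :
    extEvents (E := E) (closedBall c r)ᶜ =
      extEvents (ball c (r + ε) \ closedBall c r) ⊔ extEvents (closedBall c (r + ε / 2))ᶜ := by
  refine le_antisymm (extEvents_compl_closedBall_le_shell_sup c hr hε) (sup_le ?_ ?_)
  · exact extEvents_mono (sdiff_subset_compl _ _)
  · exact extEvents_mono (compl_subset_compl.2 (closedBall_subset_closedBall (by linarith)))

/-! ### From thick shells to the germ -/

/-- **A shell version of the exterior conditional probability.** If, under the finite measure `μ` on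
`𝓢'(E)`, the events of the open shell `B(c, r + ε) ∖ B̄(c, r)` split the interior events
`extEvents (ball c r)` from the far-exterior events `extEvents (closedBall c (r + ε/2))ᶜ` (`0 ≤ r`,
`ε > 0`), then for every interior event `A` the shell-measurable `μ⟦A | shell_ε⟧` integrates like
`1_A` on ALL exterior events: `μ (A ∩ B) = ∫⁻_B μ⟦A | shell_ε⟧ dμ`, `B ∈ extEvents (closedBall c r)ᶜ`
(from `CondIndepCondExp.measure_inter_eq_setLIntegral` and `extEvents_compl_closedBall_le_shell_sup`).
[cite: Rozanov1982, Ch. 2 §1.3] -/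
theorem measure_inter_eq_setLIntegral_condExp_shell (μ : Measure (FieldConfig E)) [IsFiniteMeasure μ]
    (c : E) {r ε : ℝ} (hr : 0 ≤ r) (hε : 0 < ε)
    (h : CondIndepCondExp (extEvents (ball c (r + ε) \ closedBall c r)) (extEvents (ball c r))
      (extEvents (closedBall c (r + ε / 2))ᶜ) μ)
    {A : Set (FieldConfig E)} (hA : MeasurableSet[extEvents (ball c r)] A)
    {B : Set (FieldConfig E)} (hB : MeasurableSet[extEvents (closedBall c r)ᶜ] B) :
    μ (A ∩ B) =
      ∫⁻ η in B, ENNReal.ofReal ((μ⟦A | extEvents (ball c (r + ε) \ closedBall c r)⟧) η) ∂μ :=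
  h.measure_inter_eq_setLIntegral (extEvents_le _) (extEvents_le _) (extEvents_le _) hA
    (extEvents_compl_closedBall_le_shell_sup c hr hε B hB)

/-- **Rozanov's passage from collars to the germ, one-sided form** (Rozanov 1982, Ch. 2 §1.3,
(1.27) ⇒ (1.29)). Let `μ` be a finite measure on `𝓢'(E)` (`E` finite-dimensional), `0 < r`, and
suppose that for EVERY width `ε > 0` the events of the open shell `B(c, r + ε) ∖ B̄(c, r)` split the
interior events `extEvents (ball c r)` from the far-exterior events `extEvents (closedBall c (r + ε/2))ᶜ`.
Then every interior event `A` has a `germEvents c r`-measurable version `g` of its conditional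
probability given the exterior events: `μ (A ∩ B) = ∫⁻_B g dμ` for all `B ∈ extEvents (closedBall c r)ᶜ`.
Proof: the shell versions `g_n = μ⟦A | shell_{1/(n+1)}⟧` all integrate like `1_A` on the exterior
events (`measure_inter_eq_setLIntegral_condExp_shell`), hence are pairwise a.e. equal; `g = limsup g_n`
is measurable for every `shell_ε` (the shells decrease), i.e. for their intersection `germEvents c r`,
and is a.e. equal to `g_0`. [cite: Rozanov1982, Ch. 2 §1.3 (1.29)] -/
theorem exists_germMeasurable_version_of_shellSplitting (μ : Measure (FieldConfig E))
    [IsFiniteMeasure μ] (c : E) {r : ℝ} (hr : 0 < r)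
    (h : ∀ ε : ℝ, 0 < ε → CondIndepCondExp (extEvents (ball c (r + ε) \ closedBall c r))
      (extEvents (ball c r)) (extEvents (closedBall c (r + ε / 2))ᶜ) μ)
    {A : Set (FieldConfig E)} (hA : MeasurableSet[extEvents (ball c r)] A) :
    ∃ g : FieldConfig E → ℝ≥0∞, Measurable[germEvents c r] g ∧
      ∀ B : Set (FieldConfig E), MeasurableSet[extEvents (closedBall c r)ᶜ] B →
        μ (A ∩ B) = ∫⁻ η in B, g η ∂μ := by
  -- the shell versions at widths `1 / (n + 1)`
  obtain ⟨G, hG⟩ : ∃ G : ℕ → FieldConfig E → ℝ≥0∞, ∀ n : ℕ, G n = fun η =>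
      ENNReal.ofReal ((μ⟦A | extEvents (ball c (r + 1 / ((n : ℝ) + 1)) \ closedBall c r)⟧) η) :=
    ⟨_, fun _ => rfl⟩
  have hGm : ∀ n : ℕ, Measurable[extEvents (ball c (r + 1 / ((n : ℝ) + 1)) \ closedBall c r)] (G n) :=
    fun n => by
      rw [hG]
      exact stronglyMeasurable_condExp.measurable.ennreal_ofReal
  have hGdlr : ∀ (n : ℕ) (B : Set (FieldConfig E)), MeasurableSet[extEvents (closedBall c r)ᶜ] B →
      μ (A ∩ B) = ∫⁻ η in B, G n η ∂μ := fun n B hB => by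
    rw [hG]
    exact measure_inter_eq_setLIntegral_condExp_shell μ c hr.le Nat.one_div_pos_of_nat
      (h _ Nat.one_div_pos_of_nat) hA hB
  have hshell_le : ∀ n : ℕ, extEvents (E := E) (ball c (r + 1 / ((n : ℝ) + 1)) \ closedBall c r) ≤
      extEvents (closedBall c r)ᶜ := fun n => extEvents_mono (sdiff_subset_compl _ _)
  -- all shell versions are a.e. equal to the first one
  have hae : ∀ n : ℕ, G n =ᵐ[μ] G 0 := fun n => by
    have h' : G n =ᵐ[μ.trim (extEvents_le (closedBall c r)ᶜ)] G 0 := by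
      refine ae_eq_of_forall_setLIntegral_eq_of_sigmaFinite (μ := μ.trim (extEvents_le _))
        ((hGm n).mono (hshell_le n) le_rfl) ((hGm 0).mono (hshell_le 0) le_rfl) ?_
      intro B hB _
      rw [setLIntegral_trim _ ((hGm n).mono (hshell_le n) le_rfl) hB,
        setLIntegral_trim _ ((hGm 0).mono (hshell_le 0) le_rfl) hB, ← hGdlr n B hB, hGdlr 0 B hB]
    exact ae_eq_of_ae_eq_trim h'
  have hall : ∀ᵐ η ∂μ, ∀ n, G n η = G 0 η := ae_all_iff.2 hae
  refine ⟨fun η => limsup (fun n => G n η) atTop, ?_, fun B hB => ?_⟩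
  · -- germ measurability: the `limsup` only sees the shells of width `≤ ε`
    refine Measurable.of_comap_le (le_iInf₂ fun ε hε => Measurable.comap_le ?_)
    obtain ⟨N, hN⟩ := exists_nat_one_div_lt hε
    have hle : ∀ n : ℕ, extEvents (E := E) (ball c (r + 1 / (((n + N : ℕ) : ℝ) + 1)) \ closedBall c r) ≤
        extEvents (ball c (r + ε) \ closedBall c r) := fun n => by
      refine extEvents_mono (sdiff_subset_sdiff_left (ball_subset_ball ?_))
      have h1 : (1 : ℝ) / (((n + N : ℕ) : ℝ) + 1) ≤ 1 / ((N : ℝ) + 1) :=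
        one_div_le_one_div_of_le (by positivity)
          (by push_cast; linarith [(Nat.cast_nonneg n : (0 : ℝ) ≤ n)])
      linarith
    have heq : (fun η => limsup (fun n => G n η) atTop) =
        fun η => limsup (fun n => G (n + N) η) atTop :=
      funext fun η => (Filter.limsup_nat_add (fun n => G n η) N).symm
    rw [heq]
    exact Measurable.limsup fun n => (hGm (n + N)).mono (hle n) le_rfl
  · -- the DLR identity: `limsup G = G 0` a.e.
    have hg : (fun η => limsup (fun n => G n η) atTop) =ᵐ[μ] G 0 := by
      filter_upwards [hall] with η hη
      rw [show (fun n => G n η) = fun _ => G 0 η from funext hη, Filter.limsup_const]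
    rw [hGdlr 0 B hB]
    exact (lintegral_congr_ae (ae_restrict_of_ae hg)).symm

end Shell

end Literature.MathematicalPhysics.QuantumLattice

end
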